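import Mathlib
import Literature.Computability.AlgebraicComplexity.ArithCircuitProofs
import Literature.Computability.AlgebraicComplexity.MatMulTotalComplexityProofs
import Literature.Computability.AlgebraicComplexity.FastFourierTransform
import Literature.LinearAlgebra.Matrix.CauchyDeterminant
import Literature.Computability.AlgebraicComplexity.DivisionSLP
import Literature.LinearAlgebra.Matrix.CauchyLike
import Summits.MatrixMultiplication.MatrixMultiplication.Theorems.HiddenToeplitzCornersToeplitzLikeDetCostMBAAux
import Summits.MatrixMultiplication.MatrixMultiplication.Theorems.HiddenToeplitzCornersToeplitzLikeDetCostCauchyMatvec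
import Summits.MatrixMultiplication.MatrixMultiplication.Theorems.HiddenToeplitzCornersToeplitzLikeDetCostCauchyAlgebra
import Summits.MatrixMultiplication.MatrixMultiplication.Theorems.HiddenToeplitzCornersToeplitzLikeDetCostFFTCost

/-!
# Stub `stub_mba` of crux `HiddenToeplitzCorners.ToeplitzLikeDetCost` (stmt-MatrixMultiplication-7491),
# line `Sketch`

The Morf/Bitmead-Anderson divide and conquer on coset-Cauchy-like matrices (K-level).

Target tree file: `Summits/MatrixMultiplication/MatrixMultiplication/Theorems/HiddenToeplitzCornersToeplitzLikeDetCostMBA.lean`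
(helper for the crux, landed with `--supports stmt-MatrixMultiplication-7491`). The theorem `stub_mba`
below must keep EXACTLY this name and signature (it is registered on the crux).

Proof: induction on `κ`. The base case is the `1 × 1` matrix; the step splits `Fin (2^(κ+1))` into
even and odd positions (`mba_parityEquiv`), so that the four blocks are Cauchy-like on cosets of
`⟨ω²⟩` (hypothesis (A4) of `halg`), recurses on the leading block and on the Schur complement in
generator form ((A1), (A6)), and assembles `det`, `C⁻¹ G`, `Hᵀ C⁻¹` by the block-inverse action
((A2), (A3), (A5)) with the abstract cost bookkeeping of `mba_assemble` (file `…MBAAux.lean`).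
-/

set_option linter.dupNamespace false


namespace Summit.MatrixMultiplication.MatrixMultiplication.Theorems

open scoped BigOperators Matrix
open Literature.Computability.AlgebraicComplexity Literature.LinearAlgebra.Matrix
open Literature.Computability.AlgebraicComplexity.ArithCircuit (FanInTwoSeq freeInputs)

noncomputable section

section KLevel
variable {K : Type} [Field K] [Algebra ℂ K]

/-- **Stub `mba`** (registered hypothesis-free; the matvec and algebra statements come from the landed
`stub_cauchyMatvec` + `fftCost` and `stub_cauchyAlgebra`) — see `Lines/Sketch.lean`. [cite: BitmeadAnderson1980, §3–4] -/
theorem stub_mba :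
    ∀ (κ : ℕ) (ω a b : ℂ), IsPrimitiveRoot ω (2 ^ κ) → a ≠ 0 → b ≠ 0 →
      (∀ i j : ℕ, a * ω ^ i ≠ b * ω ^ j) →
      ∀ (p : Type) [Fintype p] [DecidableEq p] (G H : Matrix (Fin (2 ^ κ)) p K) (A : Set K),
      (∀ i k, G i k ∈ A ∪ Set.range (algebraMap ℂ K)) →
      (∀ i k, H i k ∈ A ∪ Set.range (algebraMap ℂ K)) →
      (∀ (ι : Type) [Fintype ι] [DecidableEq ι] (g : ι → Fin (2 ^ κ)), Function.Injective g →
        ((cauchyLike (fun i : Fin (2 ^ κ) => algebraMap ℂ K (a * ω ^ (i : ℕ)))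
            (fun j : Fin (2 ^ κ) => algebraMap ℂ K (b * ω ^ (j : ℕ))) G H).submatrix g g).det ≠ 0) →
      Derivable ℂ (64 * (Fintype.card p + 1) ^ 2 * (κ + 1) ^ 2 * 2 ^ κ) A
        ({(cauchyLike (fun i : Fin (2 ^ κ) => algebraMap ℂ K (a * ω ^ (i : ℕ)))
            (fun j : Fin (2 ^ κ) => algebraMap ℂ K (b * ω ^ (j : ℕ))) G H).det} ∪
          Set.range (fun ik : Fin (2 ^ κ) × p =>
            ((cauchyLike (fun i : Fin (2 ^ κ) => algebraMap ℂ K (a * ω ^ (i : ℕ)))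
              (fun j : Fin (2 ^ κ) => algebraMap ℂ K (b * ω ^ (j : ℕ))) G H)⁻¹ * G) ik.1 ik.2) ∪
          Set.range (fun ki : p × Fin (2 ^ κ) =>
            (Hᵀ * (cauchyLike (fun i : Fin (2 ^ κ) => algebraMap ℂ K (a * ω ^ (i : ℕ)))
              (fun j : Fin (2 ^ κ) => algebraMap ℂ K (b * ω ^ (j : ℕ))) G H)⁻¹) ki.1 ki.2)) := by
  have hmv := stub_cauchyMatvec (K := K) (fftCost (K := K))
  have halg := stub_cauchyAlgebra (K := K)
  intro κ
  induction κ with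
  | zero =>
    intro ω a b hω ha hb hab p _ _ G H A hG hH hmin
    -- `Fin (2 ^ 0)` has exactly one element `i₀`
    have hi₀lt : 0 < 2 ^ 0 := Nat.two_pow_pos 0
    set i₀ : Fin (2 ^ 0) := ⟨0, hi₀lt⟩ with hi₀
    have h0 : ∀ i : Fin (2 ^ 0), i = i₀ := fun i =>
      Fin.ext (by have hi := i.2; simp only [pow_zero, Nat.lt_one_iff] at hi; exact hi)
    haveI hsub : Subsingleton (Fin (2 ^ 0)) := ⟨fun i j => (h0 i).trans (h0 j).symm⟩
    set C : Matrix (Fin (2 ^ 0)) (Fin (2 ^ 0)) K :=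
      cauchyLike (fun i : Fin (2 ^ 0) => algebraMap ℂ K (a * ω ^ (i : ℕ)))
        (fun j : Fin (2 ^ 0) => algebraMap ℂ K (b * ω ^ (j : ℕ))) G H with hC
    -- the single entry, as a weighted sum of products of generator entries
    have hc : C i₀ i₀ = ∑ k, ((a - b)⁻¹ : ℂ) • (G i₀ k * H i₀ k) := by
      rw [hC, cauchyLike_apply, Finset.sum_congr rfl (fun k _ => Algebra.smul_def _ _),
        ← Finset.mul_sum, map_inv₀, ← div_eq_inv_mul, ← map_sub]
      congr 1
      simp [hi₀]
    have hdetC : C.det = C i₀ i₀ := Matrix.det_eq_elem_of_subsingleton C i₀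
    have hc0 : C i₀ i₀ ≠ 0 := by
      rw [← hdetC]
      simpa using hmin (Fin (2 ^ 0)) id Function.injective_id
    have hCinv : C⁻¹ = Matrix.of (fun _ _ => (C i₀ i₀)⁻¹) := by
      apply Matrix.inv_eq_left_inv
      ext i j
      rw [h0 i, h0 j, Matrix.mul_apply, Fintype.sum_subsingleton _ i₀, Matrix.of_apply,
        inv_mul_cancel₀ hc0, Matrix.one_apply_eq]
    -- the computation: products, the entry, its inverse, the two scaled generators
    have st1 : Derivable ℂ (Fintype.card p) A (Set.range fun k => G i₀ k * H i₀ k) :=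
      mba_family fun k => Derivable.mul (hG i₀ k) (hH i₀ k)
    have st2 : Derivable ℂ (Fintype.card p) (A ∪ Set.range fun k => G i₀ k * H i₀ k)
        {C i₀ i₀} := by
      rw [hc, ← Finset.card_univ]
      exact Derivable.sum Finset.univ (fun _ => ((a - b)⁻¹ : ℂ)) fun k _ => Or.inl (Or.inr ⟨k, rfl⟩)
    have st12 := mba_snoc st1 st2
    have st3 : Derivable ℂ 1 (A ∪ ((Set.range fun k => G i₀ k * H i₀ k) ∪ {C i₀ i₀}))
        {(C i₀ i₀)⁻¹} :=
      Derivable.inv (Or.inl (Or.inr (Or.inr rfl))) hc0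
    have st123 := mba_snoc st12 st3
    have hcmem : (C i₀ i₀)⁻¹ ∈ A ∪ ((Set.range fun k => G i₀ k * H i₀ k) ∪ {C i₀ i₀} ∪
        {(C i₀ i₀)⁻¹}) ∪ Set.range (algebraMap ℂ K) := Or.inl (Or.inr (Or.inr rfl))
    have st4a : Derivable ℂ (Fintype.card p)
        (A ∪ ((Set.range fun k => G i₀ k * H i₀ k) ∪ {C i₀ i₀} ∪ {(C i₀ i₀)⁻¹}))
        (Set.range fun k => (C i₀ i₀)⁻¹ * G i₀ k) :=
      mba_family fun k => Derivable.mul hcmem ((hG i₀ k).imp_left Or.inl)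
    have st4b : Derivable ℂ (Fintype.card p)
        (A ∪ ((Set.range fun k => G i₀ k * H i₀ k) ∪ {C i₀ i₀} ∪ {(C i₀ i₀)⁻¹}))
        (Set.range fun k => H i₀ k * (C i₀ i₀)⁻¹) :=
      mba_family fun k => Derivable.mul ((hH i₀ k).imp_left Or.inl) hcmem
    have hfin := mba_snoc st123 (st4a.union st4b)
    refine hfin.mono ?_ Set.Subset.rfl ?_
    · have hα := Nat.zero_le (Fintype.card p)
      simp only [zero_add, one_pow, pow_zero, mul_one]
      nlinarith
    · rintro x ((hx | ⟨⟨i, k⟩, rfl⟩) | ⟨⟨k, i⟩, rfl⟩)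
      · rw [Set.mem_singleton_iff] at hx
        rw [hx, hdetC]
        exact Or.inl (Or.inl (Or.inr rfl))
      · refine Or.inr (Or.inl ⟨k, ?_⟩)
        dsimp only
        rw [hCinv, h0 i, Matrix.mul_apply, Fintype.sum_subsingleton _ i₀, Matrix.of_apply]
      · refine Or.inr (Or.inr ⟨k, ?_⟩)
        dsimp only
        rw [hCinv, h0 i, Matrix.mul_apply, Fintype.sum_subsingleton _ i₀, Matrix.of_apply,
          Matrix.transpose_apply]
  | succ κ ih =>
    intro ω a b hω ha hb hab p _ _ G H A hG hH hmin
    obtain ⟨hschur, hinv, hblk, hsplit, hdet, hminor⟩ := halg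
    -- roots of unity and coset disjointness at level `κ`
    have hω0 : ω ≠ 0 := hω.ne_zero (pow_ne_zero _ two_ne_zero)
    have hω2 : IsPrimitiveRoot (ω ^ 2) (2 ^ κ) := hω.pow (pow_pos two_pos _) (pow_succ' 2 κ)
    have haω : a * ω ≠ 0 := mul_ne_zero ha hω0
    have hbω : b * ω ≠ 0 := mul_ne_zero hb hω0
    have hll : ∀ i j : ℕ, a * (ω ^ 2) ^ i ≠ b * (ω ^ 2) ^ j := fun i j h =>
      hab (2 * i) (2 * j) (by linear_combination h)
    have hlr : ∀ i j : ℕ, a * (ω ^ 2) ^ i ≠ b * ω * (ω ^ 2) ^ j := fun i j h =>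
      hab (2 * i) (2 * j + 1) (by linear_combination h)
    have hrl : ∀ i j : ℕ, a * ω * (ω ^ 2) ^ i ≠ b * (ω ^ 2) ^ j := fun i j h =>
      hab (2 * i + 1) (2 * j) (by linear_combination h)
    have hrr : ∀ i j : ℕ, a * ω * (ω ^ 2) ^ i ≠ b * ω * (ω ^ 2) ^ j := fun i j h =>
      hab (2 * i + 1) (2 * j + 1) (by linear_combination h)
    have hba : ∀ i j : ℕ, b * (ω ^ 2) ^ i ≠ a * (ω ^ 2) ^ j := fun i j h => hll j i h.symm
    have hK : ∀ {u v : ℂ}, u ≠ v → algebraMap ℂ K u ≠ algebraMap ℂ K v := fun huv h =>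
      huv ((algebraMap ℂ K).injective h)
    -- the parity splitting and the nodes on the two halves
    obtain ⟨e, hel, her⟩ := mba_parityEquiv κ
    set xs : Fin (2 ^ (κ + 1)) → K := fun i => algebraMap ℂ K (a * ω ^ (i : ℕ)) with hxs
    set ys : Fin (2 ^ (κ + 1)) → K := fun j => algebraMap ℂ K (b * ω ^ (j : ℕ)) with hys
    set x₁ : Fin (2 ^ κ) → K := fun i => algebraMap ℂ K (a * (ω ^ 2) ^ (i : ℕ)) with hx₁
    set x₂ : Fin (2 ^ κ) → K := fun i => algebraMap ℂ K (a * ω * (ω ^ 2) ^ (i : ℕ)) with hx₂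
    set y₁ : Fin (2 ^ κ) → K := fun j => algebraMap ℂ K (b * (ω ^ 2) ^ (j : ℕ)) with hy₁
    set y₂ : Fin (2 ^ κ) → K := fun j => algebraMap ℂ K (b * ω * (ω ^ 2) ^ (j : ℕ)) with hy₂
    have hxl : xs ∘ ⇑e ∘ Sum.inl = x₁ := by
      funext i; simp only [Function.comp_apply, hxs, hx₁, hel, pow_mul]
    have hxr : xs ∘ ⇑e ∘ Sum.inr = x₂ := by
      funext i; simp only [Function.comp_apply, hxs, hx₂, her]; congr 1; ring
    have hyl : ys ∘ ⇑e ∘ Sum.inl = y₁ := by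
      funext i; simp only [Function.comp_apply, hys, hy₁, hel, pow_mul]
    have hyr : ys ∘ ⇑e ∘ Sum.inr = y₂ := by
      funext i; simp only [Function.comp_apply, hys, hy₂, her]; congr 1; ring
    -- the four blocks
    set G₁ : Matrix (Fin (2 ^ κ)) p K := G.submatrix (⇑e ∘ Sum.inl) id with hG₁
    set G₂ : Matrix (Fin (2 ^ κ)) p K := G.submatrix (⇑e ∘ Sum.inr) id with hG₂
    set H₁ : Matrix (Fin (2 ^ κ)) p K := H.submatrix (⇑e ∘ Sum.inl) id with hH₁
    set H₂ : Matrix (Fin (2 ^ κ)) p K := H.submatrix (⇑e ∘ Sum.inr) id with hH₂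
    set E : Matrix (Fin (2 ^ κ)) (Fin (2 ^ κ)) K := cauchyLike x₁ y₁ G₁ H₁ with hE
    set F : Matrix (Fin (2 ^ κ)) (Fin (2 ^ κ)) K := cauchyLike x₁ y₂ G₁ H₂ with hF
    set F' : Matrix (Fin (2 ^ κ)) (Fin (2 ^ κ)) K := cauchyLike x₂ y₁ G₂ H₁ with hF'
    set D : Matrix (Fin (2 ^ κ)) (Fin (2 ^ κ)) K := cauchyLike x₂ y₂ G₂ H₂ with hD
    set C : Matrix (Fin (2 ^ (κ + 1))) (Fin (2 ^ (κ + 1))) K := cauchyLike xs ys G H with hC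
    have hM : C.submatrix ⇑e ⇑e = Matrix.fromBlocks E F F' D := by
      rw [hC, hsplit _ _ _ _ e xs ys G H, hxl, hxr, hyl, hyr]
    -- nonsingularity of the leading block and of the Schur complement
    obtain ⟨hEmin, hSmin⟩ := mba_minors hminor C e E F F' D hM hmin
    have hEunit : IsUnit E.det :=
      isUnit_iff_ne_zero.2 (by simpa using hEmin (Fin (2 ^ κ)) id Function.injective_id)
    have hSunit : IsUnit (D - F' * E⁻¹ * F).det :=
      isUnit_iff_ne_zero.2 (by simpa using hSmin (Fin (2 ^ κ)) id Function.injective_id)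
    have h11 : ∀ i j, x₁ i ≠ y₁ j := fun i j => hK (hll i j)
    have h12 : ∀ i j, x₁ i ≠ y₂ j := fun i j => hK (hlr i j)
    have h21 : ∀ i j, x₂ i ≠ y₁ j := fun i j => hK (hrl i j)
    have h22 : ∀ i j, x₂ i ≠ y₂ j := fun i j => hK (hrr i j)
    -- Schur complement and inverse of `E` in generator form
    have hS : D - F' * E⁻¹ * F =
        cauchyLike x₂ y₂ (G₂ - F' * (E⁻¹ * G₁)) (H₂ - (E⁻¹ * F)ᵀ * H₁) :=
      hschur _ _ _ x₁ y₁ x₂ y₂ G₁ H₁ G₂ H₂ h11 h12 h21 h22 hEunit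
    have hEinv : E⁻¹ = cauchyLike y₁ x₁ (-(E⁻¹ * G₁)) ((H₁ᵀ * E⁻¹)ᵀ) :=
      hinv _ _ x₁ y₁ G₁ H₁ h11 hEunit
    have hG₁ : ∀ i k, G₁ i k ∈ A ∪ Set.range (algebraMap ℂ K) := fun i k => hG _ _
    have hG₂ : ∀ i k, G₂ i k ∈ A ∪ Set.range (algebraMap ℂ K) := fun i k => hG _ _
    have hH₁ : ∀ i k, H₁ i k ∈ A ∪ Set.range (algebraMap ℂ K) := fun i k => hH _ _
    have hH₂ : ∀ i k, H₂ i k ∈ A ∪ Set.range (algebraMap ℂ K) := fun i k => hH _ _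
    -- recursion on the leading block
    set BE : Set K := {E.det} ∪ Set.range (fun ik : Fin (2 ^ κ) × p => (E⁻¹ * G₁) ik.1 ik.2) ∪
        Set.range (fun ki : p × Fin (2 ^ κ) => (H₁ᵀ * E⁻¹) ki.1 ki.2) with hBE
    have ihE : Derivable ℂ (64 * (Fintype.card p + 1) ^ 2 * (κ + 1) ^ 2 * 2 ^ κ) A BE :=
      ih (ω ^ 2) a b hω2 ha hb hll p G₁ H₁ A hG₁ hH₁ hEmin
    -- fast products with the blocks `F`, `F'` and with `E⁻¹`
    have hops : ∀ S : Set K, A ∪ BE ⊆ S → ∀ v : Fin (2 ^ κ) → K,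
        (∀ i, v i ∈ S ∪ Set.range (algebraMap ℂ K)) →
        (Derivable ℂ (2 ^ κ * Fintype.card p + Fintype.card p * (2 * κ + 7) * 2 ^ κ) S
              (Set.range (F.mulVec v)) ∧
            Derivable ℂ (2 ^ κ * Fintype.card p + Fintype.card p * (2 * κ + 7) * 2 ^ κ) S
              (Set.range (Matrix.vecMul v F))) ∧
          (Derivable ℂ (2 ^ κ * Fintype.card p + Fintype.card p * (2 * κ + 7) * 2 ^ κ) S
              (Set.range (F'.mulVec v)) ∧
            Derivable ℂ (2 ^ κ * Fintype.card p + Fintype.card p * (2 * κ + 7) * 2 ^ κ) S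
              (Set.range (Matrix.vecMul v F'))) ∧
          (Derivable ℂ (2 ^ κ * Fintype.card p + Fintype.card p * (2 * κ + 7) * 2 ^ κ) S
              (Set.range (Matrix.mulVec E⁻¹ v)) ∧
            Derivable ℂ (2 ^ κ * Fintype.card p + Fintype.card p * (2 * κ + 7) * 2 ^ κ) S
              (Set.range (Matrix.vecMul v E⁻¹))) := by
      intro S hS v hv
      have hAS : A ⊆ S := Set.subset_union_left.trans hS
      refine ⟨?_, ?_, ?_⟩
      · have h := hmv κ (ω ^ 2) a (b * ω) hω2 ha hbω hlr p G₁ H₂ v S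
          (fun i k => (hG₁ i k).imp_left fun h => hAS h)
          (fun i k => (hH₂ i k).imp_left fun h => hAS h) hv
        exact ⟨h.1.mono (by omega) Set.Subset.rfl Set.Subset.rfl,
          h.2.mono (by omega) Set.Subset.rfl Set.Subset.rfl⟩
      · have h := hmv κ (ω ^ 2) (a * ω) b hω2 haω hb hrl p G₂ H₁ v S
          (fun i k => (hG₂ i k).imp_left fun h => hAS h)
          (fun i k => (hH₁ i k).imp_left fun h => hAS h) hv
        exact ⟨h.1.mono (by omega) Set.Subset.rfl Set.Subset.rfl,
          h.2.mono (by omega) Set.Subset.rfl Set.Subset.rfl⟩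
      · have hneg : Derivable ℂ (Fintype.card (Fin (2 ^ κ)) * Fintype.card p) S
            (Set.range fun ik : Fin (2 ^ κ) × p => (-(E⁻¹ * G₁)) ik.1 ik.2) :=
          mba_neg (E⁻¹ * G₁) fun i k => Or.inl (hS (Or.inr (Or.inl (Or.inr ⟨(i, k), rfl⟩))))
        rw [Fintype.card_fin] at hneg
        have h := hmv κ (ω ^ 2) b a hω2 hb ha hba p (-(E⁻¹ * G₁)) ((H₁ᵀ * E⁻¹)ᵀ) v
          (S ∪ Set.range fun ik : Fin (2 ^ κ) × p => (-(E⁻¹ * G₁)) ik.1 ik.2)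
          (fun i k => Or.inl (Or.inr ⟨(i, k), rfl⟩))
          (fun i k => Or.inl (Or.inl (hS (Or.inr (Or.inr ⟨(k, i), rfl⟩)))))
          (fun i => (hv i).imp_left Or.inl)
        rw [hEinv]
        exact ⟨hneg.trans h.1, hneg.trans h.2⟩
    -- recursion on the Schur complement
    have hrec : ∀ S : Set K, A ∪ BE ⊆ S →
        (∀ i k, (G₂ - F' * (E⁻¹ * G₁)) i k ∈ S ∪ Set.range (algebraMap ℂ K)) →
        (∀ j k, (H₂ - (E⁻¹ * F)ᵀ * H₁) j k ∈ S ∪ Set.range (algebraMap ℂ K)) →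
        Derivable ℂ (64 * (Fintype.card p + 1) ^ 2 * (κ + 1) ^ 2 * 2 ^ κ) S
          ({(D - F' * E⁻¹ * F).det} ∪
            Set.range (fun ik : Fin (2 ^ κ) × p =>
              ((D - F' * E⁻¹ * F)⁻¹ * (G₂ - F' * (E⁻¹ * G₁))) ik.1 ik.2) ∪
            Set.range (fun kj : p × Fin (2 ^ κ) =>
              ((H₂ - (E⁻¹ * F)ᵀ * H₁)ᵀ * (D - F' * E⁻¹ * F)⁻¹) kj.1 kj.2)) := by
      intro S _ hGt hHt
      rw [hS]
      exact ih (ω ^ 2) (a * ω) (b * ω) hω2 haω hbω hrr p _ _ S hGt hHt (by rw [← hS]; exact hSmin)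
    obtain ⟨hbY, hbW⟩ := hblk _ _ _ E F F' D G₁ H₁ G₂ H₂ hEunit hSunit
    have hasm := mba_assemble E F F' D G₁ H₁ G₂ H₂ (A ∪ BE)
      (2 ^ κ * Fintype.card p + Fintype.card p * (2 * κ + 7) * 2 ^ κ)
      (64 * (Fintype.card p + 1) ^ 2 * (κ + 1) ^ 2 * 2 ^ κ)
      (fun i k => (hG₂ i k).imp_left Or.inl) (fun i k => (hH₂ i k).imp_left Or.inl)
      (Or.inl (Or.inr (Or.inl (Or.inl rfl))))
      (fun i k => Or.inl (Or.inr (Or.inl (Or.inr ⟨(i, k), rfl⟩))))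
      (fun k i => Or.inl (Or.inr (Or.inr ⟨(k, i), rfl⟩))) hops hrec hbY hbW
    have hfin := ihE.trans hasm
    refine hfin.mono ?_ Set.Subset.rfl ?_
    · simp only [Fintype.card_fin]
      exact mba_cost (Fintype.card p) κ
    · refine (mba_target e C G H).trans ?_
      have hGs : G.submatrix ⇑e id = Matrix.fromRows G₁ G₂ := by
        ext (i | i) k <;> rfl
      have hHs : H.submatrix ⇑e id = Matrix.fromRows H₁ H₂ := by
        ext (i | i) k <;> rfl
      rw [hM, hdet _ _ E F F' D hEunit, hGs, hHs]

end KLevel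

end

end Summit.MatrixMultiplication.MatrixMultiplication.Theorems
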